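import Mathlib
import Summits.MatrixMultiplication.Statement
import Summits.MatrixMultiplication.MatrixMultiplication.Theorems.GraphEquationsTowerStep

/-!
# Graph equations — the identity tower at the generic point (M23f)

Iterating `tower_step` (M23e) `m - 1` times from the trivial stage gives, over ANY field `K` with
compatible `ℂ`- and `ℂ[a,b]`-algebra structures (finally `K = ℂ(a,b)`), the pivot-normalised identity
tower of an ideal `(t_1, …, t_T) ⊆ graphIdeal n` of local exponent `≤ m`
(`generator n q ^ m ∈ (t)` for all `q`):

`exists_towerStages` — a kernel-index type `κ`, at most `m - 1` cost-free stage derivations killing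
`a, b`, words (sublists), cost-free extras and a `K`-point `towerPt lam = (a, b, ab, lam)` such that
(P1) every word applied to every embedded `t_o`, and every extra, vanishes at the point, and
(P2) the fibre gradients (`towerRow`) of these outputs span the whole fibre cotangent space
`K^{(Fin n × Fin n) ⊕ κ}` — i.e. the tower system is REGULAR at the generic point of the graph with
respect to the fibre variables `c, λ`.  This is the algebraic heart of the S1 supply (NODE-g36 §3); the
specialisation to a `ℂ`-point and the section jet (`hsec`) are separate files.
-/

set_option linter.dupNamespace false

noncomputable section

open scoped BigOperators

namespace Summit.MatrixMultiplication.MatrixMultiplication.Theorems.GraphEquations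

open MvPolynomial
open Literature.Computability.AlgebraicComplexity

variable {n : ℕ}

section Stages

variable (K : Type*) [Field K] [Algebra ℂ K] [Algebra (MvPolynomial (MatMulVars n) ℂ) K]

/-- The stage invariant of the identity tower at kernel-index type `κ`, stage `j`, for the
exponent `m`: data `Ds, W, ex` with output set `G` satisfying clauses (1)–(7) of `tower_step`. -/
def StageInv {T : ℕ} (t : Fin T → MvPolynomial (GraphVars n) ℂ) (m j : ℕ) (κ : Type) [Fintype κ]
    [DecidableEq κ] (lam : κ → K) : Prop :=
  ∃ (Ds : List (Derivation ℂ (MvPolynomial (GraphVars n ⊕ κ) ℂ) (MvPolynomial (GraphVars n ⊕ κ) ℂ)))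
    (W : List (List (Derivation ℂ (MvPolynomial (GraphVars n ⊕ κ) ℂ)
      (MvPolynomial (GraphVars n ⊕ κ) ℂ))))
    (ex : List (MvPolynomial (GraphVars n ⊕ κ) ℂ)) (G : Set (MvPolynomial (GraphVars n ⊕ κ) ℂ)),
    G = {g | ∃ o, ∃ w ∈ W, g = w.foldl (fun acc D => D acc) (rename Sum.inl (t o))} ∪
      {e | e ∈ ex} ∧
    Ds.length = j ∧ (∀ w ∈ W, w.Sublist Ds) ∧
    (∀ D ∈ Ds, (∀ v, D (X v) ∈ freeSpan ∅) ∧ ∀ v : MatMulVars n, D (X (Sum.inl (Sum.inl v))) = 0) ∧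
    (∀ e ∈ ex, e ∈ freeSpan ∅) ∧ (∀ g ∈ G, aeval (towerPt lam) g = 0) ∧
    (∀ q, (∃ u, aeval (towerPt lam) u ≠ 0 ∧
        u * rename Sum.inl (generator n q) ^ (m - j) ∈ Ideal.span G) ∨
      (Pi.single (Sum.inl q) 1 : (Fin n × Fin n) ⊕ κ → K) ∈ Submodule.span K (towerRow lam '' G)) ∧
    (∀ i : κ, (Pi.single (Sum.inr i) 1 : (Fin n × Fin n) ⊕ κ → K) ∈
      Submodule.span K (towerRow lam '' G) ⊔
        Submodule.span K (Set.range fun q => (Pi.single (Sum.inl q) 1 : (Fin n × Fin n) ⊕ κ → K)))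

variable {K}

/-- Stage `0`: no kernel variables, no derivations, the single empty word, no extras. -/
theorem stageInv_zero [IsScalarTower ℂ (MvPolynomial (MatMulVars n) ℂ) K] {T : ℕ}
    (t : Fin T → MvPolynomial (GraphVars n) ℂ) (ht : ∀ o, t o ∈ graphIdeal n) (m : ℕ)
    (hgen : ∀ q, generator n q ^ m ∈ Ideal.span (Set.range t)) :
    StageInv K t m 0 (Fin 0) (fun i => (Fin.elim0 i : K)) := by
  classical
  refine ⟨[], [[]], [], _, rfl, rfl, ?_, ?_, ?_, ?_, ?_, fun i => Fin.elim0 i⟩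
  · intro w hw
    rw [List.mem_singleton] at hw
    subst hw
    exact List.Sublist.slnil
  · intro D hD; simp at hD
  · intro e he; simp at he
  · rintro g (⟨o, w, hw, rfl⟩ | he)
    · rw [List.mem_singleton] at hw
      subst hw
      rw [List.foldl_nil]
      exact aeval_towerPt_rename_inl_eq_zero _ (ht o)
    · simp at he
  · intro q
    left
    refine ⟨1, by rw [map_one]; exact one_ne_zero, ?_⟩
    rw [one_mul, Nat.sub_zero]
    have := Ideal.mem_map_of_mem
      (rename Sum.inl : MvPolynomial (GraphVars n) ℂ →ₐ[ℂ] MvPolynomial (GraphVars n ⊕ Fin 0) ℂ)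
      (hgen q)
    rw [Ideal.map_span, map_pow] at this
    refine Ideal.span_mono ?_ this
    rintro _ ⟨_, ⟨o, rfl⟩, rfl⟩
    exact Or.inl ⟨o, [], List.mem_singleton_self _, rfl⟩

/-- Stage `j → j + 1` (repackaging of `tower_step`). -/
theorem stageInv_succ {T : ℕ} {t : Fin T → MvPolynomial (GraphVars n) ℂ} {m j : ℕ} {κ : Type}
    [Fintype κ] [DecidableEq κ] {lam : κ → K} (h : StageInv K t m j κ lam) (hjm : j + 2 ≤ m) :
    ∃ lam' : κ ⊕ ((Fin n × Fin n) ⊕ κ) → K, StageInv K t m (j + 1) (κ ⊕ ((Fin n × Fin n) ⊕ κ)) lam' := by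
  obtain ⟨Ds, W, ex, G, hG, h1, h2, h3, h4, h5, h6, h7⟩ := h
  obtain ⟨Ds', W', ex', lam', G', hG', h1', h2', h3', h4', h5', h6', h7'⟩ :=
    tower_step t hjm Ds W ex lam G hG h1 h2 h3 h4 h5 h6 h7
  exact ⟨lam', Ds', W', ex', G', hG', h1', h2', h3', h4', h5', h6', h7'⟩

/-- All stages `j ≤ m - 1` exist. -/
theorem exists_stageInv [IsScalarTower ℂ (MvPolynomial (MatMulVars n) ℂ) K] {T : ℕ}
    (t : Fin T → MvPolynomial (GraphVars n) ℂ) (ht : ∀ o, t o ∈ graphIdeal n) (m : ℕ)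
    (hgen : ∀ q, generator n q ^ m ∈ Ideal.span (Set.range t)) :
    ∀ j, j + 1 ≤ m →
      ∃ (κ : Type) (_ : Fintype κ) (_ : DecidableEq κ) (lam : κ → K), StageInv K t m j κ lam
  | 0, _ => ⟨Fin 0, inferInstance, inferInstance, _, stageInv_zero t ht m hgen⟩
  | j + 1, hj => by
    obtain ⟨κ, _, _, lam, hinv⟩ := exists_stageInv t ht m hgen j (by omega)
    obtain ⟨lam', h'⟩ := stageInv_succ hinv (by omega)
    exact ⟨_, inferInstance, inferInstance, lam', h'⟩

/-- **Regularity at the last stage.**  At stage `j = m - 1` (exponent `1`) the rows span the whole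
fibre cotangent space. -/
theorem span_towerRow_eq_top_of_stageInv [IsScalarTower ℂ (MvPolynomial (MatMulVars n) ℂ) K]
    {m j : ℕ} (hmj : m - j = 1) {κ : Type} [Fintype κ] [DecidableEq κ] {lam : κ → K}
    {G : Set (MvPolynomial (GraphVars n ⊕ κ) ℂ)}
    (h5 : ∀ g ∈ G, aeval (towerPt lam) g = 0)
    (h6 : ∀ q, (∃ u, aeval (towerPt lam) u ≠ 0 ∧
        u * rename Sum.inl (generator n q) ^ (m - j) ∈ Ideal.span G) ∨
      (Pi.single (Sum.inl q) 1 : (Fin n × Fin n) ⊕ κ → K) ∈ Submodule.span K (towerRow lam '' G))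
    (h7 : ∀ i : κ, (Pi.single (Sum.inr i) 1 : (Fin n × Fin n) ⊕ κ → K) ∈
      Submodule.span K (towerRow lam '' G) ⊔
        Submodule.span K (Set.range fun q => (Pi.single (Sum.inl q) 1 : (Fin n × Fin n) ⊕ κ → K))) :
    Submodule.span K (towerRow lam '' G) = ⊤ := by
  classical
  have hF0 : ∀ q, aeval (towerPt lam)
      (rename Sum.inl (generator n q) : MvPolynomial (GraphVars n ⊕ κ) ℂ) = 0 := fun q =>
    aeval_towerPt_rename_inl_eq_zero lam (Ideal.subset_span ⟨q, rfl⟩)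
  have hcq : ∀ q, (Pi.single (Sum.inl q) 1 : (Fin n × Fin n) ⊕ κ → K) ∈
      Submodule.span K (towerRow lam '' G) := by
    intro q
    rcases h6 q with ⟨u, hu0, hu⟩ | hq
    · rw [hmj, pow_one] at hu
      have hrow := row_mem_span_rows (K := K) (towerPt lam)
        (Sum.elim (fun q : Fin n × Fin n => (Sum.inl (Sum.inr q) : GraphVars n ⊕ κ)) Sum.inr) h5 hu
      rw [row_mul_of_aeval_eq_zero _ _ (hF0 q)] at hrow
      have := Submodule.smul_mem _ (aeval (towerPt lam) u)⁻¹ hrow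
      rw [smul_smul, inv_mul_cancel₀ hu0, one_smul] at this
      rw [← towerRow_generator lam q]
      exact this
    · exact hq
  have hki : ∀ i : κ, (Pi.single (Sum.inr i) 1 : (Fin n × Fin n) ⊕ κ → K) ∈
      Submodule.span K (towerRow lam '' G) := by
    intro i
    have hle : Submodule.span K (towerRow lam '' G) ⊔
        Submodule.span K (Set.range fun q => (Pi.single (Sum.inl q) 1 : (Fin n × Fin n) ⊕ κ → K)) ≤
        Submodule.span K (towerRow lam '' G) :=
      sup_le le_rfl (by
        rw [Submodule.span_le]
        rintro _ ⟨q, rfl⟩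
        exact hcq q)
    exact hle (h7 i)
  rw [eq_top_iff]
  rintro v -
  rw [pi_eq_sum_univ v]
  refine Submodule.sum_mem _ fun y _ => ?_
  rw [ite_eq_single]
  rcases y with q | i
  · exact Submodule.smul_mem _ _ (hcq q)
  · exact Submodule.smul_mem _ _ (hki i)

/-- **The identity tower at the generic point (E1 output).**  For `t ⊆ graphIdeal n` with
`generator n q ^ m ∈ (t)` for all `q` and `1 ≤ m`, over any field `K ⊇ ℂ[a,b] ⊇ ℂ`: a kernel-index
type `κ`, `≤ m - 1` cost-free stage derivations killing `a, b`, words, cost-free extras and a point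
`lam` with (P1) all outputs vanish at `towerPt lam` and (P2) their fibre gradients span `⊤`. -/
theorem exists_towerStages [IsScalarTower ℂ (MvPolynomial (MatMulVars n) ℂ) K] {T : ℕ}
    (t : Fin T → MvPolynomial (GraphVars n) ℂ) (ht : ∀ o, t o ∈ graphIdeal n) {m : ℕ} (hm : 1 ≤ m)
    (hgen : ∀ q, generator n q ^ m ∈ Ideal.span (Set.range t)) :
    ∃ (κ : Type) (_ : Fintype κ) (_ : DecidableEq κ)
      (Ds : List (Derivation ℂ (MvPolynomial (GraphVars n ⊕ κ) ℂ) (MvPolynomial (GraphVars n ⊕ κ) ℂ)))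
      (W : List (List (Derivation ℂ (MvPolynomial (GraphVars n ⊕ κ) ℂ)
        (MvPolynomial (GraphVars n ⊕ κ) ℂ))))
      (ex : List (MvPolynomial (GraphVars n ⊕ κ) ℂ)) (lam : κ → K),
      Ds.length + 1 = m ∧ (∀ w ∈ W, w.Sublist Ds) ∧
      (∀ D ∈ Ds, (∀ v, D (X v) ∈ freeSpan ∅) ∧ ∀ v : MatMulVars n, D (X (Sum.inl (Sum.inl v))) = 0) ∧
      (∀ e ∈ ex, e ∈ freeSpan ∅) ∧
      (∀ o, ∀ w ∈ W, aeval (towerPt lam) (w.foldl (fun acc D => D acc) (rename Sum.inl (t o))) = 0) ∧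
      (∀ e ∈ ex, aeval (towerPt lam) e = 0) ∧
      Submodule.span K (towerRow lam ''
        ({g | ∃ o, ∃ w ∈ W, g = w.foldl (fun acc D => D acc) (rename Sum.inl (t o))} ∪
          {e | e ∈ ex})) = ⊤ := by
  obtain ⟨κ, _, _, lam, Ds, W, ex, G, hG, h1, h2, h3, h4, h5, h6, h7⟩ :=
    exists_stageInv (K := K) t ht m hgen (m - 1) (by omega)
  have htop := span_towerRow_eq_top_of_stageInv (K := K) (by omega) h5 h6 h7
  refine ⟨κ, inferInstance, inferInstance, Ds, W, ex, lam, by omega, h2, h3, h4, ?_, ?_, ?_⟩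
  · exact fun o w hw => h5 _ (by rw [hG]; exact Or.inl ⟨o, w, hw, rfl⟩)
  · exact fun e he => h5 _ (by rw [hG]; exact Or.inr he)
  · rw [← hG]; exact htop

end Stages

end Summit.MatrixMultiplication.MatrixMultiplication.Theorems.GraphEquations

end
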